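/-
Origin: expansion seat `planner-pub-hodgecm-mc-unitary-1-g9-0`, handover #E1 2026-08-20T07:53:03Z md5 1cd8ed622986 (r3 = r2 without the #print tail; NEW additive KERNEL leaf: η-factor of hκ on K_∞ in letters + typed pin χV := χOfType nV; imports installed RUN-38/40/41 modules only; rowdeps none; drop-alone) (`HOME/mc/pub-hodgecm-mc-unitary-1-g9/stage44/HodgeCM/Model/WmEtaKInf.lean`, md5 1cd8ed622986, 265 lines);
landed by the second packager p2 gen 4 (p2-g4) in gate run 44 as `HodgeCM/Model/WmEtaKInf.lean` (verbatim).
-/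
/-
Origin: speedrun cell pub-hodgecm, MODEL-CONSTRUCTION sub-cell, lineage mc-unitary-1 (BINDER-OWNERS row 4 `W`; MODEL-DAG node W2-Kn «K-norm»
+ (v19-a) `wm` lineage + W8 unitary line characters), seat planner-pub-hodgecm-mc-unitary-1-g9-0 (gen 9), 2026-08-20.
Target in PKG: `HodgeCM/Model/WmEtaKInf.lean` (NEW additive leaf; imports this lineage's `Model/ThetaAdelicSideEta` (RUN 37) and binder-2's
`Model/HypCensus/InsMemPin` (#48, RUN 40) + `Model/HypCensus/KInfLetters` (#50, RUN 41); nothing installed is touched).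
KERNEL ONLY: 0 records, nothing cited as hypothesis, 0 `def … : Prop`, 0 new `def` (theorems only).
-/
import Summits.HodgeConjecture.HodgeCM.Model.ThetaAdelicSideEta
import Summits.HodgeConjecture.HodgeCM.Model.HypCensus.InsMemPin
import Summits.HodgeConjecture.HodgeCM.Model.HypCensus.KInfLetters

/-!
# W block (row 4 `W`), node W2-Kn: THE VALUE OF `η` ON `K_∞` — the `η`-factor of the census residual `hκ`, in letters

The W pin of record `wmInputCM₂g V S hGR η hη hηc τ T hT` carries the det-twist character
`η = cmDetTwistChar (frameD V) (dW S) (χ_V ∘ det) (χ_W ∘ det)` (`EtaChi.η`, `Model/ThetaAdelicSideEta` §3).  Binder-2's census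
(#48 `InsMemPin`, #49, #51, #56 `HypOfCensus`) reduces the field `ins_mem` of rows 18/19 to ONE value identity on `K_∞`

  `hκ : η (kPair k) · pinLetterChar (kVLetters (lett k)) · dVIota (lett k v(ι₁)) = archKappa k`   (`k ∈ KInfty V`),

whose first factor is this lineage's object.  This leaf EVALUATES that factor, kernel-only:

* §1 `cmDetTwistChar_kPair` — `η (kPair k) = χ_V [det_∞ (frameG⁻¹ k frameG)]` (the `W`-coordinate of `kPair k` is `1`; vendored
  `cmDetTwistChar_archToAdelic_one` of this lineage's `…CMTwistDetArch`), and the frame-free reading `cmDetTwistChar_kPair_eq_of_hm`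
  (`= χ_V [det_∞ k]` in `U(V.Hm)`, via `cmKTypeHom_archToAdelic`);
* §2 `coe_cmDetTwistChar_kPair_of_hasArchType` — under an archimedean type `χ_V,∞ (y) = ∏_w y_w ^ (n w)`:
  `η (kPair k) = ∏_{w ∣ ∞ of L} det ((frameG⁻¹ k frameG)_w) ^ (n w)` (and `= ∏_w det (k_w) ^ (n w)`, `coe_cmDetTwistChar_kPair_of_hasArchType_hm`);
* §3 `det_lett_fst_mul_det_lett_snd` — the letters carry the place determinants: `det (lett k v).1 · det (lett k v).2 = det ((frameG⁻¹ k frameG)_{w(v)})`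
  (#50 `kV_lettAt` + `cmPlaceComponent_fst` + vendored `det_coe_toUForm`);
* §4 **`coe_cmDetTwistChar_kPair_eq_prod_lett`** — IN LETTERS: `η (kPair k) = ∏_{v real place of L⁺} (det (lett k v).1 · det (lett k v).2) ^ (n w(v))`,
  `w(v) = cmPlaceOver v`; §5 `η_kPair`, `coe_η_kPair_of_hasArchType`, **`coe_η_kPair_eq_prod_lett`** — the same three statements for sinst-1's family term
  `EtaChi.η @χV @χW V c` at `S := c.D` (the spelling of `hκ` in #56/#71/#396), and `coe_η_χOfType_kPair_eq_prod_lett` — the TYPED PIN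
  `χ_V := EtaChi.χOfType nV` with `hn` discharged, any `χ_W`.  One namespace `HodgeCM.Model.WmEta` (new; nothing enters `HypCensus`/`EtaChi`).

So, given the archimedean type `n` of `χ_V V c` (a CITE-level datum of the unitary line character, [GR91 §3.1 Remark p. 457 L9–13]),
the `η`-factor of `hκ` is an explicit monomial in the letter determinants and `hκ` no longer mentions `χ_W` at all.
Nothing here is a claim of PerL/QW8.  Style lint (L-notation): no `local notation`.
-/

set_option autoImplicit false

noncomputable section

open NumberField NumberField.InfinitePlace
open scoped Matrix Classical
open Literature.NumberTheory.Automorphic Literature.NumberTheory.Automorphic.UnitaryGroup Literature.NumberTheory.Weil1964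
open Literature.RepresentationTheory.KonnoKonno2007 Literature.RepresentationTheory.KonnoKonno2007.RealDualPair
open Literature.NumberTheory.GelbartRogawski1991 Literature.NumberTheory.GelbartRogawski1991.UnitaryDualPair
open Literature.Geometry.ComplexHyperbolic Literature.Geometry.ComplexHyperbolic.BallModel

namespace HodgeCM.Model.WmEta

open HodgeCM.Model.HypCensus

variable {L : CMField} {ι₁ : L →+* ℂ} (V : HermSpace3 L ι₁) (S : StubTree.SeesawDatum L)
variable (χV χW : ContinuousMonoidHom
  (Literature.NumberTheory.Automorphic.relNormOneIdeles (↥(maximalRealSubfield L)) (L : Type) ⧸ Literature.NumberTheory.Automorphic.relNormOneRat (↥(maximalRealSubfield L)) (L : Type)) Circle)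

variable {n : InfinitePlace (L : Type) → ℤ}

/-! ## §1 `η (kPair k) = χ_V [det_∞ (frameG⁻¹ k frameG)]` -/

section AnyFrame

variable (τ : (L : Type) →+* ℂ) (T : GL (Fin 3) ℂ) (hT : formCongr (starRingEnd ℂ) T (V.Hm.map τ) = J)

/-- `kPair k = ((frameG⁻¹ k frameG)_𝔸, 1)`: the `W`-coordinate of the pin pair is `1` (`map_one`). -/
theorem kPair_eq_archToAdelic (k : ↥(UnitaryGroup.archIsotropy (L : Type) V.Hm τ T hT)) :
    kPair V S τ T hT k =
      ((UnitaryGroup.archToAdelic (↥(maximalRealSubfield L)) (L : Type) (IsCMField.complexConj L) 3 (Matrix.diagonal (frameD V))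
          (archFrameConj (L : Type) 3 V.Hm (frameG V) (frameD V) (frame_congr V)
            (k : UnitaryGroup.arch (↥(maximalRealSubfield L)) (L : Type) (IsCMField.complexConj L) 3 V.Hm)), 1) :
        CMAdelic (L : Type) (frameD V) × CMAdelic (L : Type) (dW S)) := by
  apply Prod.ext
  · rfl
  · change UnitaryGroup.archToAdelic (↥(maximalRealSubfield L)) (L : Type) (IsCMField.complexConj L) 2 (Matrix.diagonal (dW S)) 1 = 1
    rw [map_one]

/-- **`η (kPair k) = χ_V [det_∞ (frameG⁻¹ k frameG)]`**: the `W`-coordinate of `kPair k` is `1`, so only the `χ_V ∘ det` factor of the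
det-twist character survives, read on the archimedean determinant idele of the framed element. [folklore] -/
theorem cmDetTwistChar_kPair (k : ↥(UnitaryGroup.archIsotropy (L : Type) V.Hm τ T hT)) :
    cmDetTwistChar (L : Type) (frameD V) (frameD_ne V) (dW S) (dW_ne S)
        (charOfUnitaryLineChar (L : Type) χV) (charOfUnitaryLineChar (L : Type) χW) (kPair V S τ T hT k) =
      Circle.toUnits (χV (Literature.NumberTheory.Automorphic.relNormOneInfToQuot (↥(maximalRealSubfield L)) (L : Type)
        (UnitaryGroup.cmArchDet (L : Type) 3 (Matrix.diagonal (frameD V)) (det_diagonal_ne_zero (L : Type) (frameD V) (frameD_ne V))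
          (archFrameConj (L : Type) 3 V.Hm (frameG V) (frameD V) (frame_congr V)
            (k : UnitaryGroup.arch (↥(maximalRealSubfield L)) (L : Type) (IsCMField.complexConj L) 3 V.Hm))))) := by
  rw [kPair_eq_archToAdelic V S τ T hT k,
    cmDetTwistChar_archToAdelic_one]

/-- the frame-free reading: **`η (kPair k) = χ_V [det_∞ k]`** with `det_∞` taken in `U(V.Hm)(L ⊗ ℝ)` itself (`frameG⁻¹ k frameG` and `k`
have the same determinant idele; vendored `cmKTypeHom_archToAdelic` + `cmDetTwistChar_cmKTypeHom_archToAdelic`). [folklore] -/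
theorem cmDetTwistChar_kPair_eq_of_hm (k : ↥(UnitaryGroup.archIsotropy (L : Type) V.Hm τ T hT)) :
    cmDetTwistChar (L : Type) (frameD V) (frameD_ne V) (dW S) (dW_ne S)
        (charOfUnitaryLineChar (L : Type) χV) (charOfUnitaryLineChar (L : Type) χW) (kPair V S τ T hT k) =
      Circle.toUnits (χV (Literature.NumberTheory.Automorphic.relNormOneInfToQuot (↥(maximalRealSubfield L)) (L : Type)
        (UnitaryGroup.cmArchDet (L : Type) 3 V.Hm (det_ne_zero_of_frame (L : Type) V.Hm (frameG V) (frameD V) (frame_congr V) (frameD_ne V))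
          (k : UnitaryGroup.arch (↥(maximalRealSubfield L)) (L : Type) (IsCMField.complexConj L) 3 V.Hm)))) := by
  rw [kPair_eq_archToAdelic V S τ T hT k,
    ← cmKTypeHom_archToAdelic, cmDetTwistChar_cmKTypeHom_archToAdelic]

/-! ## §2 Under an archimedean type: `η (kPair k) = ∏_w det ((frameG⁻¹ k frameG)_w) ^ (n w)` -/

/-- **`η (kPair k) = ∏_{w ∣ ∞} det ((frameG⁻¹ k frameG)_w) ^ (n w)`** when `χ_V` has archimedean type `n`
(`χ_V [y] = ∏_w y_w ^ (n w)` on `(L ⊗ ℝ)^{N=1}`). [cite: GelbartRogawski1991, §3.1 Remark p. 457 L9–13] -/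
theorem coe_cmDetTwistChar_kPair_of_hasArchType (hn : UnitaryLineChar.HasArchType (L : Type) χV n)
    (k : ↥(UnitaryGroup.archIsotropy (L : Type) V.Hm τ T hT)) :
    ((cmDetTwistChar (L : Type) (frameD V) (frameD_ne V) (dW S) (dW_ne S)
        (charOfUnitaryLineChar (L : Type) χV) (charOfUnitaryLineChar (L : Type) χW) (kPair V S τ T hT k) : ℂˣ) : ℂ) =
      ∏ w : InfinitePlace (L : Type),
        (((UnitaryGroup.archAt (↥(maximalRealSubfield L)) (L : Type) (IsCMField.complexConj L) 3 (Matrix.diagonal (frameD V))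
            ⟨w, IsTotallyComplex.isComplex w⟩ (UnitaryGroup.complexConj_smul_infinitePlace (L : Type) w) (IsCMField.complexConj_ne_one (L : Type))
            (archFrameConj (L : Type) 3 V.Hm (frameG V) (frameD V) (frame_congr V)
              (k : UnitaryGroup.arch (↥(maximalRealSubfield L)) (L : Type) (IsCMField.complexConj L) 3 V.Hm)) :
            UnitaryGroup.archLocal (L : Type) 3 (Matrix.diagonal (frameD V)) ⟨w, IsTotallyComplex.isComplex w⟩) : GL (Fin 3) ℂ) :
            Matrix (Fin 3) (Fin 3) ℂ).det ^ (n w) := by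
  rw [cmDetTwistChar_kPair, Circle.toUnits_apply, Units.val_mk0, (UnitaryLineChar.hasArchType_iff (L : Type) χV n).1 hn, Literature.NumberTheory.Automorphic.archWeight_eq_prod]
  exact Finset.prod_congr rfl fun w _ => by rw [coe_archPlaceChar_cmArchDet']

/-- the frame-free reading: **`η (kPair k) = ∏_{w ∣ ∞} det (k_w) ^ (n w)`** with `k_w ∈ U(σ_w V.Hm)(ℂ)` the place components of `k` itself.
[cite: GelbartRogawski1991, §3.1 Remark p. 457 L9–13] -/
theorem coe_cmDetTwistChar_kPair_of_hasArchType_hm (hn : UnitaryLineChar.HasArchType (L : Type) χV n)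
    (k : ↥(UnitaryGroup.archIsotropy (L : Type) V.Hm τ T hT)) :
    ((cmDetTwistChar (L : Type) (frameD V) (frameD_ne V) (dW S) (dW_ne S)
        (charOfUnitaryLineChar (L : Type) χV) (charOfUnitaryLineChar (L : Type) χW) (kPair V S τ T hT k) : ℂˣ) : ℂ) =
      ∏ w : InfinitePlace (L : Type),
        (((UnitaryGroup.archAt (↥(maximalRealSubfield L)) (L : Type) (IsCMField.complexConj L) 3 V.Hm
            ⟨w, IsTotallyComplex.isComplex w⟩ (UnitaryGroup.complexConj_smul_infinitePlace (L : Type) w) (IsCMField.complexConj_ne_one (L : Type))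
            (k : UnitaryGroup.arch (↥(maximalRealSubfield L)) (L : Type) (IsCMField.complexConj L) 3 V.Hm) :
            UnitaryGroup.archLocal (L : Type) 3 V.Hm ⟨w, IsTotallyComplex.isComplex w⟩) : GL (Fin 3) ℂ) :
            Matrix (Fin 3) (Fin 3) ℂ).det ^ (n w) := by
  rw [cmDetTwistChar_kPair_eq_of_hm, Circle.toUnits_apply, Units.val_mk0, (UnitaryLineChar.hasArchType_iff (L : Type) χV n).1 hn,
    Literature.NumberTheory.Automorphic.archWeight_eq_prod]
  exact Finset.prod_congr rfl fun w _ => by rw [coe_archPlaceChar_cmArchDet']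

end AnyFrame

/-! ## §3 The letters carry the place determinants -/

/-- **`det (lett k v).1 · det (lett k v).2 = det ((frameG⁻¹ k frameG)_{w(v)})`**: the `V`-letters at the real place `v` of `L⁺` are the blocks of
the Sylvester-framed `w(v)`-component (#50 `kV_lettAt`, `cmPlaceComponent_fst`), and framing preserves determinants (`det_coe_toUForm`). [folklore] -/
theorem det_lett_fst_mul_det_lett_snd (k : ↥(KInfty V)) (v : {v : InfinitePlace ↥(maximalRealSubfield L) // v.IsReal}) :
    ((lett V S k v).1 : Matrix (PosIdx (cmXV (L : Type) (frameD V) (frameD_real V) ι₁ v)) (PosIdx (cmXV (L : Type) (frameD V) (frameD_real V) ι₁ v)) ℂ).det *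
        ((lett V S k v).2 : Matrix (NegIdx (cmXV (L : Type) (frameD V) (frameD_real V) ι₁ v)) (NegIdx (cmXV (L : Type) (frameD V) (frameD_real V) ι₁ v)) ℂ).det =
      (((UnitaryGroup.archAt (↥(maximalRealSubfield L)) (L : Type) (IsCMField.complexConj L) 3 (Matrix.diagonal (frameD V))
          (cmPlaceOver (L : Type) v) (cmPlaceOver_smul (L : Type) v) (IsCMField.complexConj_ne_one (L : Type))
          (archFrameConj (L : Type) 3 V.Hm (frameG V) (frameD V) (frame_congr V)
            (k : UnitaryGroup.arch (↥(maximalRealSubfield L)) (L : Type) (IsCMField.complexConj L) 3 V.Hm)) :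
          UnitaryGroup.archLocal (L : Type) 3 (Matrix.diagonal (frameD V)) (cmPlaceOver (L : Type) v)) : GL (Fin 3) ℂ) :
          Matrix (Fin 3) (Fin 3) ℂ).det := by
  have h := congrArg
    (fun u : UForm (PosIdx (cmXV (L : Type) (frameD V) (frameD_real V) ι₁ v)) (NegIdx (cmXV (L : Type) (frameD V) (frameD_real V) ι₁ v)) =>
      (((u : GL (PosIdx (cmXV (L : Type) (frameD V) (frameD_real V) ι₁ v) ⊕ NegIdx (cmXV (L : Type) (frameD V) (frameD_real V) ι₁ v)) ℂ) :
        Matrix (PosIdx (cmXV (L : Type) (frameD V) (frameD_real V) ι₁ v) ⊕ NegIdx (cmXV (L : Type) (frameD V) (frameD_real V) ι₁ v))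
          (PosIdx (cmXV (L : Type) (frameD V) (frameD_real V) ι₁ v) ⊕ NegIdx (cmXV (L : Type) (frameD V) (frameD_real V) ι₁ v)) ℂ)).det)
    (kV_lettAt V S v k)
  simp only [UForm.coe_kV, Matrix.det_fromBlocks_zero₂₁] at h
  rw [lett_apply, h, cmPlaceComponent_fst, det_coe_toUForm]
  rfl

/-- the chosen complex place over the restriction of `w` is `w` (#50 `cmPlaceOver_cmPlaceUnder`, in the `cmPlacesEquiv` spelling). -/
theorem cmPlaceOver_cmPlacesEquiv (w : InfinitePlace (L : Type)) :
    cmPlaceOver (L : Type) (cmPlacesEquiv (L : Type) w) = ⟨w, IsTotallyComplex.isComplex w⟩ :=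
  (congrArg (cmPlaceOver (L : Type)) (Subtype.ext rfl : cmPlacesEquiv (L : Type) w = cmPlaceUnder (L : Type) ⟨w, IsTotallyComplex.isComplex w⟩)).trans
    (cmPlaceOver_cmPlaceUnder (L : Type) ⟨w, IsTotallyComplex.isComplex w⟩)

/-! ## §4 `η (kPair k)` in letters -/

/-- **THE `η`-FACTOR OF `hκ` IN LETTERS**: for `k ∈ K_∞` and `χ_V` of archimedean type `n`,
`η (kPair k) = ∏_{v real} (det (lett k v).1 · det (lett k v).2) ^ (n w(v))`, `w(v) = cmPlaceOver v` the complex place of `L` over `v`.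
[cite: GelbartRogawski1991, §3.1 Remark p. 457 L9–13] -/
theorem coe_cmDetTwistChar_kPair_eq_prod_lett (hn : UnitaryLineChar.HasArchType (L : Type) χV n) (k : ↥(KInfty V)) :
    ((cmDetTwistChar (L : Type) (frameD V) (frameD_ne V) (dW S) (dW_ne S)
        (charOfUnitaryLineChar (L : Type) χV) (charOfUnitaryLineChar (L : Type) χW)
        (kPair V S ι₁ V.sylvesterFrame (sylvesterFrame_formCongr V) k) : ℂˣ) : ℂ) =
      ∏ v : {v : InfinitePlace ↥(maximalRealSubfield L) // v.IsReal},
        (((lett V S k v).1 : Matrix (PosIdx (cmXV (L : Type) (frameD V) (frameD_real V) ι₁ v)) (PosIdx (cmXV (L : Type) (frameD V) (frameD_real V) ι₁ v)) ℂ).det *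
          ((lett V S k v).2 : Matrix (NegIdx (cmXV (L : Type) (frameD V) (frameD_real V) ι₁ v)) (NegIdx (cmXV (L : Type) (frameD V) (frameD_real V) ι₁ v)) ℂ).det) ^
          (n (cmPlaceOver (L : Type) v).1) := by
  rw [coe_cmDetTwistChar_kPair_of_hasArchType V S χV χW ι₁ V.sylvesterFrame (sylvesterFrame_formCongr V) hn k]
  refine Fintype.prod_equiv (cmPlacesEquiv (L : Type)) _ _ fun w => ?_
  rw [det_lett_fst_mul_det_lett_snd]
  -- transport the place term `cmPlaceOver (cmPlacesEquiv w) = ⟨w, _⟩` through the dependent arguments of `archAt`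
  have key : ∀ (w' : {w : InfinitePlace (L : Type) // w.IsComplex}) (hw' : IsCMField.complexConj (L : Type) • w'.1 = w'.1),
      w' = ⟨w, IsTotallyComplex.isComplex w⟩ →
        (((UnitaryGroup.archAt (↥(maximalRealSubfield L)) (L : Type) (IsCMField.complexConj L) 3 (Matrix.diagonal (frameD V))
            w' hw' (IsCMField.complexConj_ne_one (L : Type))
            (archFrameConj (L : Type) 3 V.Hm (frameG V) (frameD V) (frame_congr V)
              (k : UnitaryGroup.arch (↥(maximalRealSubfield L)) (L : Type) (IsCMField.complexConj L) 3 V.Hm)) :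
            UnitaryGroup.archLocal (L : Type) 3 (Matrix.diagonal (frameD V)) w') : GL (Fin 3) ℂ) : Matrix (Fin 3) (Fin 3) ℂ).det ^ (n w'.1) =
        (((UnitaryGroup.archAt (↥(maximalRealSubfield L)) (L : Type) (IsCMField.complexConj L) 3 (Matrix.diagonal (frameD V))
            ⟨w, IsTotallyComplex.isComplex w⟩ (UnitaryGroup.complexConj_smul_infinitePlace (L : Type) w) (IsCMField.complexConj_ne_one (L : Type))
            (archFrameConj (L : Type) 3 V.Hm (frameG V) (frameD V) (frame_congr V)
              (k : UnitaryGroup.arch (↥(maximalRealSubfield L)) (L : Type) (IsCMField.complexConj L) 3 V.Hm)) :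
            UnitaryGroup.archLocal (L : Type) 3 (Matrix.diagonal (frameD V)) ⟨w, IsTotallyComplex.isComplex w⟩) : GL (Fin 3) ℂ) :
            Matrix (Fin 3) (Fin 3) ℂ).det ^ (n w) := by
    rintro w' hw' rfl
    rfl
  exact (key _ _ (cmPlaceOver_cmPlacesEquiv w)).symm

/-! ## §5 The family term `EtaChi.η @χV @χW V c` (the spelling of `hκ` in #56 `HypOfCensus` / #71 / #396) -/

section Family

variable
  (χV χW : ∀ {L : CMField} {ι₁ : L →+* ℂ} (_V : HermSpace3 L ι₁) (_c : SeesawCtx L),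
    ContinuousMonoidHom (Literature.NumberTheory.Automorphic.relNormOneIdeles (maximalRealSubfield (L : Type)) (L : Type) ⧸
      Literature.NumberTheory.Automorphic.relNormOneRat (maximalRealSubfield (L : Type)) (L : Type)) Circle)

/-- **`η V c (kPair k) = χ_V V c [det_∞ (frameG⁻¹ k frameG)]`** for the family term, any frame `(τ, T)`. [folklore] -/
theorem η_kPair {L : CMField} {ι₁ : L →+* ℂ} (V : HermSpace3 L ι₁) (c : SeesawCtx L)
    (τ : (L : Type) →+* ℂ) (T : GL (Fin 3) ℂ) (hT : formCongr (starRingEnd ℂ) T (V.Hm.map τ) = J)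
    (k : ↥(UnitaryGroup.archIsotropy (L : Type) V.Hm τ T hT)) :
    EtaChi.η @χV @χW V c (kPair V c.D τ T hT k) =
      Circle.toUnits (χV V c (Literature.NumberTheory.Automorphic.relNormOneInfToQuot (↥(maximalRealSubfield L)) (L : Type)
        (UnitaryGroup.cmArchDet (L : Type) 3 (Matrix.diagonal (frameD V)) (det_diagonal_ne_zero (L : Type) (frameD V) (frameD_ne V))
          (archFrameConj (L : Type) 3 V.Hm (frameG V) (frameD V) (frame_congr V)
            (k : UnitaryGroup.arch (↥(maximalRealSubfield L)) (L : Type) (IsCMField.complexConj L) 3 V.Hm))))) :=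
  cmDetTwistChar_kPair V c.D (χV V c) (χW V c) τ T hT k

/-- **`η V c (kPair k) = ∏_w det ((frameG⁻¹ k frameG)_w) ^ (n w)`** for the family term under an archimedean type `n` of `χ_V V c`.
[cite: GelbartRogawski1991, §3.1 Remark p. 457 L9–13] -/
theorem coe_η_kPair_of_hasArchType {L : CMField} {ι₁ : L →+* ℂ} (V : HermSpace3 L ι₁) (c : SeesawCtx L)
    (τ : (L : Type) →+* ℂ) (T : GL (Fin 3) ℂ) (hT : formCongr (starRingEnd ℂ) T (V.Hm.map τ) = J)
    {n : InfinitePlace (L : Type) → ℤ} (hn : UnitaryLineChar.HasArchType (L : Type) (χV V c) n)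
    (k : ↥(UnitaryGroup.archIsotropy (L : Type) V.Hm τ T hT)) :
    ((EtaChi.η @χV @χW V c (kPair V c.D τ T hT k) : ℂˣ) : ℂ) =
      ∏ w : InfinitePlace (L : Type),
        (((UnitaryGroup.archAt (↥(maximalRealSubfield L)) (L : Type) (IsCMField.complexConj L) 3 (Matrix.diagonal (frameD V))
            ⟨w, IsTotallyComplex.isComplex w⟩ (UnitaryGroup.complexConj_smul_infinitePlace (L : Type) w) (IsCMField.complexConj_ne_one (L : Type))
            (archFrameConj (L : Type) 3 V.Hm (frameG V) (frameD V) (frame_congr V)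
              (k : UnitaryGroup.arch (↥(maximalRealSubfield L)) (L : Type) (IsCMField.complexConj L) 3 V.Hm)) :
            UnitaryGroup.archLocal (L : Type) 3 (Matrix.diagonal (frameD V)) ⟨w, IsTotallyComplex.isComplex w⟩) : GL (Fin 3) ℂ) :
            Matrix (Fin 3) (Fin 3) ℂ).det ^ (n w) :=
  coe_cmDetTwistChar_kPair_of_hasArchType V c.D (χV V c) (χW V c) τ T hT hn k

/-- **THE `η`-FACTOR OF `hκ` IN LETTERS, family spelling** (frame of record `(ι₁, V.sylvesterFrame)`, `k ∈ KInfty V`):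
`η V c (kPair k) = ∏_{v real} (det (lett V c.D k v).1 · det (lett V c.D k v).2) ^ (n w(v))`. [cite: GelbartRogawski1991, §3.1 Remark p. 457 L9–13] -/
theorem coe_η_kPair_eq_prod_lett {L : CMField} {ι₁ : L →+* ℂ} (V : HermSpace3 L ι₁) (c : SeesawCtx L)
    {n : InfinitePlace (L : Type) → ℤ} (hn : UnitaryLineChar.HasArchType (L : Type) (χV V c) n) (k : ↥(KInfty V)) :
    ((EtaChi.η @χV @χW V c (kPair V c.D ι₁ V.sylvesterFrame (sylvesterFrame_formCongr V) k) : ℂˣ) : ℂ) =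
      ∏ v : {v : InfinitePlace ↥(maximalRealSubfield L) // v.IsReal},
        (((lett V c.D k v).1 : Matrix (PosIdx (cmXV (L : Type) (frameD V) (frameD_real V) ι₁ v)) (PosIdx (cmXV (L : Type) (frameD V) (frameD_real V) ι₁ v)) ℂ).det *
          ((lett V c.D k v).2 : Matrix (NegIdx (cmXV (L : Type) (frameD V) (frameD_real V) ι₁ v)) (NegIdx (cmXV (L : Type) (frameD V) (frameD_real V) ι₁ v)) ℂ).det) ^
          (n (cmPlaceOver (L : Type) v).1) :=
  coe_cmDetTwistChar_kPair_eq_prod_lett V c.D (χV V c) (χW V c) hn k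

/-- **THE TYPED PIN**: for the TERM character family `χ_V := EtaChi.χOfType nV` (prescribed archimedean types `nV V c`, sinst-1 ∕ unitary-1
`unitaryLineCharOfType`) the hypothesis `hn` is discharged (`EtaChi.hasArchType_χOfType`):
`η V c (kPair k) = ∏_{v real} (det (lett V c.D k v).1 · det (lett V c.D k v).2) ^ (nV V c w(v))`, for ANY `χ_W`. [cite: GelbartRogawski1991, §3.1 Remark p. 457 L9–13] -/
theorem coe_η_χOfType_kPair_eq_prod_lett
    (nV : ∀ {L : CMField} {ι₁ : L →+* ℂ} (_V : HermSpace3 L ι₁) (_c : SeesawCtx L), NumberField.InfinitePlace (L : Type) → ℤ)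
    {L : CMField} {ι₁ : L →+* ℂ} (V : HermSpace3 L ι₁) (c : SeesawCtx L) (k : ↥(KInfty V)) :
    ((EtaChi.η @(@EtaChi.χOfType @nV) @χW V c (kPair V c.D ι₁ V.sylvesterFrame (sylvesterFrame_formCongr V) k) : ℂˣ) : ℂ) =
      ∏ v : {v : InfinitePlace ↥(maximalRealSubfield L) // v.IsReal},
        (((lett V c.D k v).1 : Matrix (PosIdx (cmXV (L : Type) (frameD V) (frameD_real V) ι₁ v)) (PosIdx (cmXV (L : Type) (frameD V) (frameD_real V) ι₁ v)) ℂ).det *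
          ((lett V c.D k v).2 : Matrix (NegIdx (cmXV (L : Type) (frameD V) (frameD_real V) ι₁ v)) (NegIdx (cmXV (L : Type) (frameD V) (frameD_real V) ι₁ v)) ℂ).det) ^
          (nV V c (cmPlaceOver (L : Type) v).1) :=
  coe_cmDetTwistChar_kPair_eq_prod_lett V c.D (EtaChi.χOfType @nV V c) (χW V c) (EtaChi.hasArchType_χOfType @nV V c) k

end Family

end HodgeCM.Model.WmEta

end
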